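import Literature.Computability.MetaComplexity.FregeProofs
import Literature.Computability.Complexity.TautCertificates
import HarnessLib

/-!
# A string-level verifier for `textbookFrege` proofs, I: codes, the step model, soundness

Towards the discharge of `Literature.Computability.Complexity.textbookFrege_hasPolyTimeVerifier`
(`Complexity/ProofComplexityNP.lean`; Cook–Reckhow 1979, closing remark of §1: a Frege system,
with formulas written as strings and proofs as sequences of lines, is a proof system in the
abstract sense of Def. 1.3, i.e. proofs are checkable in polynomial time). This file is the
machine-free half: it fixes the certificate format and the *functional model* of the checker,
and proves the model sound. The polynomial-time realisation of the model by the tree's `FP`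
bricks and the completeness half are in the sibling files `FregeVerifierBricks.lean`,
`FregeVerifierMachine.lean`.

## The certificate format ("pool-annotated Frege proofs")

Formulas are handled as their prefix codes over *bit-string* variables,
`scode : PropForm (List Bool) → List Bool` (the tree's `PropForm.code` of a formula over `ℕ`
is `scode` of its relabelling by `encodeNat`, `code_eq_scode`); `scode` is injective
(`scode_injective`, prefix decoding). A certificate is a list of *items* `(kind, a, b, c)` of
four bit strings, processed left to right by a state `(ok, lines, pool)`:

* pool items (`kind = tag 0 … tag 5`) add one string to the `pool` of certified formula
  codes: the code of a variable `var a` (computed from `a`), of a constant, or of `¬A`, `A ∧ B`,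
  `A ∨ B` for codes `a = scode A`, `b = scode B` that must already be in the pool — so every
  pool entry is a genuine code without any parsing (`PoolInv`);
* rule items (`kind = tag (6 + i)`, `i < 9`) apply rule `i` of `textbookFrege` with the
  metavariables `A, B, C ↦ a, b, c`: the three strings must be pool entries, every premise of
  the rule, instantiated *as a string* (`sfill`), must occur among the `lines` derived so far,
  and then the instantiated conclusion is added to `lines`. Since pool entries are codes,
  string instantiation is code of formula instantiation (`sfill_eq_scode`), string equality is
  formula equality (`scode_injective`), and soundness of the rules of `textbookFrege`
  (`isSound_textbookFrege`) makes every line the code of a tautology (`LinesInv`, `run_sound`).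

Acceptance for a target formula `φ` means: `ok` stayed `true` and the last line is `φ.code`;
then `φ` is a tautology (`isTautology_of_run`). All checks are string equalities, memberships
and concatenations, which is what makes the polynomial-time realisation a composition of
existing bricks.

## References

* S. A. Cook, R. A. Reckhow, *The relative efficiency of propositional proof systems*,
  J. Symbolic Logic 44 (1979) 36–50: §1 (closing remark, pp. 39–40), §2 Def. 2.1–2.2,
  Lemma 2.5.
* S. R. Buss, *An introduction to proof theory*, in: Handbook of Proof Theory (1998), §1.1
  (Frege proofs; recognising proofs in polynomial time).
-/

namespace Literature.Computability.MetaComplexity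

open _root_.Computability Complexity

namespace FregeVerifier

/-! ### Codes of formulas over bit-string variables -/

/-- The prefix code of a formula whose variables are bit strings: the tree's `PropForm.code`
with the variable payload written verbatim (`var bs ↦ 00·⟨bs, ε⟩`, `const b ↦ 01b`,
`neg ↦ 10·…`, `conj ↦ 110·…·…`, `disj ↦ 111·…·…`). [cite: AroraBarakCC2009, §0.1] -/
def scode : PropForm (List Bool) → List Bool
  | .var bs => false :: false :: boolPair bs []
  | .const b => [false, true, b]
  | .neg φ => true :: false :: scode φ
  | .conj φ ψ => true :: true :: false :: (scode φ ++ scode ψ)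
  | .disj φ ψ => true :: true :: true :: (scode φ ++ scode ψ)

/-- `scode` is the bit code of the token string (`untok ∘ toks` of `TautCertificates.lean`).
[folklore] -/
theorem scode_eq_untok_toks (φ : PropForm (List Bool)) : scode φ = untok φ.toks := by
  induction φ with
  | var bs => simp [scode, PropForm.toks, FTok.bits]
  | const b => rfl
  | neg φ ih => simp [scode, PropForm.toks, FTok.bits, ih]
  | conj φ ψ ih₁ ih₂ => simp [scode, PropForm.toks, FTok.bits, ih₁, ih₂]
  | disj φ ψ ih₁ ih₂ => simp [scode, PropForm.toks, FTok.bits, ih₁, ih₂]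

/-- The tree's code of a formula over `ℕ` is the string code of its binary relabelling.
[folklore] -/
theorem code_eq_scode (φ : PropForm ℕ) : φ.code = scode (φ.mapVars encodeNat) := by
  rw [scode_eq_untok_toks, PropForm.code_eq_untok_toks]

/-- Length of a code: three bits per constant and binary connective, two per negation,
`2|bs| + 4` per variable occurrence `var bs`. [folklore] -/
theorem length_scode_le {B : ℕ} (φ : PropForm (List Bool)) (h : ∀ bs ∈ φ.varList, bs.length ≤ B) :
    (scode φ).length ≤ (2 * B + 4) * φ.size := by
  induction φ with
  | var bs =>
    have := h bs (by simp [PropForm.varList])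
    simp only [scode, List.length_cons, length_boolPair, List.length_nil, PropForm.size]
    omega
  | const b => simp [scode, PropForm.size]
  | neg φ ih =>
    have := ih (fun bs hbs => h bs (by simpa [PropForm.varList] using hbs))
    simp only [scode, List.length_cons, PropForm.size]
    nlinarith
  | conj φ ψ ih₁ ih₂ =>
    have h₁ := ih₁ (fun bs hbs => h bs (by simp [PropForm.varList, hbs]))
    have h₂ := ih₂ (fun bs hbs => h bs (by simp [PropForm.varList, hbs]))
    simp only [scode, List.length_cons, List.length_append, PropForm.size]
    nlinarith
  | disj φ ψ ih₁ ih₂ =>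
    have h₁ := ih₁ (fun bs hbs => h bs (by simp [PropForm.varList, hbs]))
    have h₂ := ih₂ (fun bs hbs => h bs (by simp [PropForm.varList, hbs]))
    simp only [scode, List.length_cons, List.length_append, PropForm.size]
    nlinarith

/-- The variable payload `⟨bs, ε⟩` is self-delimiting: it determines `bs` and the position where
the rest starts. [cite: AroraBarakCC2009, §0.1] -/
theorem boolPair_nil_append_inj : ∀ {bs bs' r r' : List Bool},
    boolPair bs [] ++ r = boolPair bs' [] ++ r' → bs = bs' ∧ r = r'
  | [], [], r, r', h => by simpa [boolPair] using h
  | [], b' :: bs', r, r', h => by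
    simp only [boolPair, List.flatMap_nil, List.nil_append, List.append_nil, List.flatMap_cons,
      List.cons_append, List.cons.injEq, List.append_assoc] at h
    obtain ⟨h1, h2, -⟩ := h
    cases b' <;> simp_all
  | b :: bs, [], r, r', h => by
    simp only [boolPair, List.flatMap_nil, List.nil_append, List.append_nil, List.flatMap_cons,
      List.cons_append, List.cons.injEq, List.append_assoc] at h
    obtain ⟨h1, h2, -⟩ := h
    cases b <;> simp_all
  | b :: bs, b' :: bs', r, r', h => by
    simp only [boolPair, List.append_nil, List.flatMap_cons, List.cons_append, List.cons.injEq,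
      List.append_assoc] at h
    obtain ⟨rfl, -, h⟩ := h
    have h' : boolPair bs [] ++ r = boolPair bs' [] ++ r' := by simpa [boolPair] using h
    obtain ⟨rfl, rfl⟩ := boolPair_nil_append_inj h'
    exact ⟨rfl, rfl⟩

/-- **Prefix decoding**: a code followed by anything determines the formula and the rest.
[cite: AroraBarakCC2009, §0.1] -/
theorem scode_append_inj : ∀ {φ ψ : PropForm (List Bool)} {r r' : List Bool},
    scode φ ++ r = scode ψ ++ r' → φ = ψ ∧ r = r'
  | .var bs, ψ, r, r', h => by
    cases ψ <;> simp only [scode, List.cons_append, List.cons.injEq, List.nil_append] at h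
    · obtain ⟨-, -, h⟩ := h
      obtain ⟨rfl, rfl⟩ := boolPair_nil_append_inj h
      exact ⟨rfl, rfl⟩
    all_goals simp_all
  | .const b, ψ, r, r', h => by
    cases ψ <;> simp only [scode, List.cons_append, List.cons.injEq, List.nil_append] at h
    · simp_all
    · obtain ⟨-, -, rfl, rfl⟩ := h; exact ⟨rfl, rfl⟩
    all_goals simp_all
  | .neg φ, ψ, r, r', h => by
    cases ψ <;> simp only [scode, List.cons_append, List.cons.injEq, List.nil_append] at h
    · simp_all
    · simp_all
    · obtain ⟨-, -, h⟩ := h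
      obtain ⟨rfl, rfl⟩ := scode_append_inj h
      exact ⟨rfl, rfl⟩
    all_goals simp_all
  | .conj φ φ', ψ, r, r', h => by
    cases ψ <;> simp only [scode, List.cons_append, List.cons.injEq, List.nil_append,
      List.append_assoc] at h
    · simp_all
    · simp_all
    · simp_all
    · obtain ⟨-, -, -, h⟩ := h
      obtain ⟨rfl, h2⟩ := scode_append_inj h
      obtain ⟨rfl, rfl⟩ := scode_append_inj h2
      exact ⟨rfl, rfl⟩
    · simp_all
  | .disj φ φ', ψ, r, r', h => by
    cases ψ <;> simp only [scode, List.cons_append, List.cons.injEq, List.nil_append,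
      List.append_assoc] at h
    · simp_all
    · simp_all
    · simp_all
    · simp_all
    · obtain ⟨-, -, -, h⟩ := h
      obtain ⟨rfl, h2⟩ := scode_append_inj h
      obtain ⟨rfl, rfl⟩ := scode_append_inj h2
      exact ⟨rfl, rfl⟩

/-- `scode` is injective. [cite: AroraBarakCC2009, §0.1] -/
theorem scode_injective : Function.Injective scode := fun φ ψ h => by
  have h' : scode φ ++ [] = scode ψ ++ [] := by rw [h]
  exact (scode_append_inj h').1

/-! ### String-level substitution into templates -/

/-- Instantiating a template `T` (a rule formula over the metavariables `0, 1, 2, …`) by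
strings: the code of `T` with the string `s i` written in place of each occurrence of `var i`.
When the `s i` are codes this is the code of the instantiated formula (`sfill_eq_scode`).
[cite: CookReckhow1979, §2 Def. 2.1 (substitution)] -/
def sfill (s : ℕ → List Bool) : PropForm ℕ → List Bool
  | .var i => s i
  | .const b => [false, true, b]
  | .neg T => true :: false :: sfill s T
  | .conj T U => true :: true :: false :: (sfill s T ++ sfill s U)
  | .disj T U => true :: true :: true :: (sfill s T ++ sfill s U)

/-- Substitution of formulas over bit-string variables for the metavariables of a template.
[cite: CookReckhow1979, §2 Def. 2.1 (substitution)] -/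
def substL (θ : ℕ → PropForm (List Bool)) : PropForm ℕ → PropForm (List Bool)
  | .var i => θ i
  | .const b => .const b
  | .neg T => .neg (substL θ T)
  | .conj T U => .conj (substL θ T) (substL θ U)
  | .disj T U => .disj (substL θ T) (substL θ U)

/-- String instantiation by codes is the code of the instantiation. [folklore] -/
theorem sfill_eq_scode {s : ℕ → List Bool} {θ : ℕ → PropForm (List Bool)} (T : PropForm ℕ)
    (h : ∀ i ∈ T.varList, s i = scode (θ i)) : sfill s T = scode (substL θ T) := by
  induction T with
  | var i => simpa [sfill, substL, PropForm.varList] using h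
  | const b => rfl
  | neg T ih => simp [sfill, substL, scode, ih (fun i hi => h i (by simpa [PropForm.varList] using hi))]
  | conj T U ih₁ ih₂ =>
    simp [sfill, substL, scode, ih₁ (fun i hi => h i (by simp [PropForm.varList, hi])),
      ih₂ (fun i hi => h i (by simp [PropForm.varList, hi]))]
  | disj T U ih₁ ih₂ =>
    simp [sfill, substL, scode, ih₁ (fun i hi => h i (by simp [PropForm.varList, hi])),
      ih₂ (fun i hi => h i (by simp [PropForm.varList, hi]))]

/-- Semantics of `substL`. [folklore] -/
@[simp] theorem eval_substL (θ : ℕ → PropForm (List Bool)) (τ : List Bool → Bool) (T : PropForm ℕ) :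
    (substL θ T).eval τ = T.eval fun i => (θ i).eval τ := by
  induction T <;> simp_all [substL, PropForm.eval]

/-- Relabelling an instance is instantiating by the relabelled substitution. [folklore] -/
theorem mapVars_subst (f : ℕ → List Bool) (σ : ℕ → PropForm ℕ) (T : PropForm ℕ) :
    (T.subst σ).mapVars f = substL (fun i => (σ i).mapVars f) T := by
  induction T <;> simp_all [PropForm.subst, PropForm.mapVars, substL]

/-- Length of a string instance: three bits per node plus the inserted strings.
[folklore] -/
theorem length_sfill_le (s : ℕ → List Bool) (T : PropForm ℕ) :
    (sfill s T).length ≤ 3 * T.size + (T.varList.map fun i => (s i).length).sum := by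
  induction T with
  | var i => simp [sfill, PropForm.size, PropForm.varList]
  | const b => simp [sfill, PropForm.size, PropForm.varList]
  | neg T ih => simp only [sfill, List.length_cons, PropForm.size, PropForm.varList]; omega
  | conj T U ih₁ ih₂ =>
    simp only [sfill, List.length_cons, List.length_append, PropForm.size, PropForm.varList,
      List.map_append, List.sum_append]; omega
  | disj T U ih₁ ih₂ =>
    simp only [sfill, List.length_cons, List.length_append, PropForm.size, PropForm.varList,
      List.map_append, List.sum_append]; omega

/-! ### The rules of `textbookFrege` as data -/

/-- Every rule of `textbookFrege` uses only the metavariables `0, 1, 2`. [cite: Shoenfield1967, §2.6] -/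
theorem vars_lt_three_of_mem_rules {r : FregeRule} (hr : r ∈ textbookFrege.rules) :
    ∀ p ∈ r.conclusion :: r.premises, ∀ v ∈ p.varList, v < 3 := by
  simp only [textbookFrege, List.mem_cons, List.not_mem_nil, or_false] at hr
  rcases hr with rfl | rfl | rfl | rfl | rfl | rfl | rfl | rfl | rfl <;>
    simp [PropForm.varList]

/-- In every rule of `textbookFrege`, each metavariable occurs at most twice in the
conclusion: the inserted strings contribute at most `2 (|s 0| + |s 1| + |s 2|)` to the length
of an instantiated conclusion. [cite: Shoenfield1967, §2.6] -/
theorem sum_varList_conclusion_le {r : FregeRule} (hr : r ∈ textbookFrege.rules) (s : ℕ → List Bool) :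
    (r.conclusion.varList.map fun i => (s i).length).sum ≤
      2 * ((s 0).length + (s 1).length + (s 2).length) := by
  simp only [textbookFrege, List.mem_cons, List.not_mem_nil, or_false] at hr
  rcases hr with rfl | rfl | rfl | rfl | rfl | rfl | rfl | rfl | rfl <;>
    simp [PropForm.varList] <;> omega

/-- Conclusions of `textbookFrege` rules have at most `12` nodes. [cite: Shoenfield1967, §2.6] -/
theorem size_conclusion_le {r : FregeRule} (hr : r ∈ textbookFrege.rules) : r.conclusion.size ≤ 12 := by
  simp only [textbookFrege, List.mem_cons, List.not_mem_nil, or_false] at hr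
  rcases hr with rfl | rfl | rfl | rfl | rfl | rfl | rfl | rfl | rfl <;>
    simp [PropForm.size]

/-- `textbookFrege` has nine rules. [cite: Shoenfield1967, §2.6] -/
@[simp] theorem length_rules : textbookFrege.rules.length = 9 := rfl

/-! ### The functional model of the checker -/

/-- The state of the checker: the verdict so far, the derived lines and the pool of certified
formula codes (both most recent first). [folklore] -/
structure MState where
  /-- no check has failed so far -/
  ok : Bool
  /-- codes of the lines derived so far, most recent first -/
  lines : List (List Bool)
  /-- certified formula codes, most recent first -/
  pool : List (List Bool)

/-- The kind tags of items: `tag n = 1ⁿ⁺¹`. Kinds `0–5` are pool items (variable, `⊤`, `⊥`,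
negation, conjunction, disjunction), kinds `6 + i` (`i < 9`) apply rule `i` of `textbookFrege`.
[folklore] -/
def tag (n : ℕ) : List Bool := List.replicate (n + 1) true

/-- The number of item kinds (`6` pool kinds and `9` rules). [folklore] -/
def numKinds : ℕ := 15

/-- `tag` is injective. [folklore] -/
theorem tag_injective : Function.Injective tag := fun m n h => by
  have := congrArg List.length h
  simp [tag] at this
  exact this

/-- The string added to the pool by a pool item of kind `n` with payloads `a`, `b`: the code
of `var a`, `⊤`, `⊥`, `¬A`, `A ∧ B`, `A ∨ B` respectively (for `a = scode A`, `b = scode B`).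
[folklore] -/
def poolOut : ℕ → List Bool → List Bool → List Bool
  | 0, a, _ => false :: false :: boolPair a []
  | 1, _, _ => [false, true, true]
  | 2, _, _ => [false, true, false]
  | 3, a, _ => true :: false :: a
  | 4, a, b => true :: true :: false :: (a ++ b)
  | _, a, b => true :: true :: true :: (a ++ b)

/-- The check of a pool item: the constituents of a compound code must already be certified.
[folklore] -/
def poolOk : ℕ → List Bool → List Bool → List (List Bool) → Bool
  | 0, _, _, _ => true
  | 1, _, _, _ => true
  | 2, _, _, _ => true
  | 3, a, _, pool => decide (a ∈ pool)
  | _, a, b, pool => decide (a ∈ pool) && decide (b ∈ pool)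

/-- The string substitution `A, B, C ↦ a, b, c` (metavariables `≥ 3` do not occur in the
rules, `vars_lt_three_of_mem_rules`). [folklore] -/
def sv (a b c : List Bool) : ℕ → List Bool
  | 0 => a
  | 1 => b
  | 2 => c
  | _ => []

/-- The check of a rule item: every premise instance (as a string) is among the derived lines,
and the three substituted strings are certified codes. [cite: CookReckhow1979, §2 Def. 2.1] -/
def ruleOk (r : FregeRule) (s : ℕ → List Bool) (lines pool : List (List Bool)) : Bool :=
  (r.premises.all fun p => decide (sfill s p ∈ lines)) &&
    (decide (s 0 ∈ pool) && (decide (s 1 ∈ pool) && decide (s 2 ∈ pool)))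

/-- Processing an item of kind `n` with payloads `a, b, c`. Pool kinds extend the pool, rule
kinds extend the lines by the instantiated conclusion; the verdict records whether the check
passed (the new string is added regardless, which keeps the machine branch-free). [folklore] -/
def applyKind (n : ℕ) (a b c : List Bool) (st : MState) : MState :=
  if n < 6 then ⟨st.ok && poolOk n a b st.pool, st.lines, poolOut n a b :: st.pool⟩
  else match textbookFrege.rules[n - 6]? with
    | some r => ⟨st.ok && ruleOk r (sv a b c) st.lines st.pool,
        sfill (sv a b c) r.conclusion :: st.lines, st.pool⟩
    | none => ⟨false, st.lines, st.pool⟩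

/-- The kind named by a tag string, if any. [folklore] -/
def kindOf (kind : List Bool) : Option ℕ :=
  (List.range numKinds).find? fun n => decide (tag n = kind)

/-- **One step of the checker** on an item `(kind, a, b, c)`: dispatch on the kind tag; an
unknown tag fails. [folklore] -/
def stepModel (kind a b c : List Bool) (st : MState) : MState :=
  match kindOf kind with
  | some n => applyKind n a b c st
  | none => ⟨false, st.lines, st.pool⟩

/-- Running the checker over a list of items. [folklore] -/
def run : List (List Bool × List Bool × List Bool × List Bool) → MState → MState
  | [], st => st
  | (k, a, b, c) :: rest, st => run rest (stepModel k a b c st)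

/-- The initial state: no failure, no lines, empty pool. [folklore] -/
def init : MState := ⟨true, [], []⟩

/-- `run` over a concatenation. [folklore] -/
theorem run_append (is js : List (List Bool × List Bool × List Bool × List Bool)) (st : MState) :
    run (is ++ js) st = run js (run is st) := by
  induction is generalizing st with
  | nil => rfl
  | cons i is ih => obtain ⟨k, a, b, c⟩ := i; exact ih _

/-- `kindOf (tag n) = some n` for `n < 15`. [folklore] -/
theorem kindOf_tag {n : ℕ} (hn : n < numKinds) : kindOf (tag n) = some n := by
  unfold kindOf
  rw [List.find?_range_eq_some]
  refine ⟨by simp, List.mem_range.2 hn, fun j hj => ?_⟩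
  have hne : tag j ≠ tag n := fun h => absurd (tag_injective h) (by omega)
  simp [hne]

/-! ### Soundness of the model -/

/-- Pool invariant: every certified string is the code of a formula. [folklore] -/
def PoolInv (pool : List (List Bool)) : Prop :=
  ∀ e ∈ pool, ∃ θ : PropForm (List Bool), e = scode θ

/-- Lines invariant: every derived string is the code of a tautology. [folklore] -/
def LinesInv (lines : List (List Bool)) : Prop :=
  ∀ L ∈ lines, ∃ θ : PropForm (List Bool), L = scode θ ∧ θ.IsTautology

/-- A successful pool item adds a code. [folklore] -/
theorem poolInv_cons {n : ℕ} {a b : List Bool} {pool : List (List Bool)} (hP : PoolInv pool)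
    (hok : poolOk n a b pool = true) : PoolInv (poolOut n a b :: pool) := by
  intro e he
  rcases List.mem_cons.1 he with rfl | he
  · match n, hok with
    | 0, _ => exact ⟨.var a, rfl⟩
    | 1, _ => exact ⟨.const true, rfl⟩
    | 2, _ => exact ⟨.const false, rfl⟩
    | 3, hok =>
      simp only [poolOk, decide_eq_true_eq] at hok
      obtain ⟨θ, rfl⟩ := hP a hok
      exact ⟨.neg θ, rfl⟩
    | 4, hok =>
      simp only [poolOk, Bool.and_eq_true, decide_eq_true_eq] at hok
      obtain ⟨θ, rfl⟩ := hP a hok.1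
      obtain ⟨ψ, rfl⟩ := hP b hok.2
      exact ⟨.conj θ ψ, rfl⟩
    | n + 5, hok =>
      simp only [poolOk, Bool.and_eq_true, decide_eq_true_eq] at hok
      obtain ⟨θ, rfl⟩ := hP a hok.1
      obtain ⟨ψ, rfl⟩ := hP b hok.2
      exact ⟨.disj θ ψ, rfl⟩
  · exact hP e he

/-- **A successful rule item adds the code of a tautology** (soundness of the rules of
`textbookFrege`, `isSound_textbookFrege`, transported along `scode`: premise instances found
among the lines are codes of tautologies, string equality is formula equality by
`scode_injective`). [cite: CookReckhow1979, §2 Def. 2.1 ("if A₁, …, Aₙ ⊢ B then A₁, …, Aₙ ⊨ B")] -/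
theorem linesInv_cons {r : FregeRule} (hr : r ∈ textbookFrege.rules) {s : ℕ → List Bool}
    {lines pool : List (List Bool)} (hP : PoolInv pool) (hL : LinesInv lines)
    (hok : ruleOk r s lines pool = true) : LinesInv (sfill s r.conclusion :: lines) := by
  simp only [ruleOk, Bool.and_eq_true, List.all_eq_true, decide_eq_true_eq] at hok
  obtain ⟨hprem, h0, h1, h2⟩ := hok
  obtain ⟨θ0, hθ0⟩ := hP _ h0
  obtain ⟨θ1, hθ1⟩ := hP _ h1
  obtain ⟨θ2, hθ2⟩ := hP _ h2
  -- the formula substitution read off the certified strings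
  let θ : ℕ → PropForm (List Bool) := fun i =>
    match i with | 0 => θ0 | 1 => θ1 | 2 => θ2 | _ => .const true
  have hsθ : ∀ p ∈ r.conclusion :: r.premises, sfill s p = scode (substL θ p) := by
    intro p hp
    refine sfill_eq_scode p fun i hi => ?_
    have hi3 := vars_lt_three_of_mem_rules hr p hp i hi
    match i, hi3 with
    | 0, _ => exact hθ0
    | 1, _ => exact hθ1
    | 2, _ => exact hθ2
  have hsound : r.IsSound := isSound_textbookFrege r hr
  intro L hLmem
  rcases List.mem_cons.1 hLmem with rfl | hLmem
  · refine ⟨substL θ r.conclusion, hsθ _ (by simp), fun τ => ?_⟩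
    rw [eval_substL]
    refine hsound _ fun p hp => ?_
    have hpl : sfill s p ∈ lines := hprem p hp
    obtain ⟨θ', hθ', htaut⟩ := hL _ hpl
    rw [hsθ p (List.mem_cons_of_mem _ hp)] at hθ'
    have := htaut τ
    rwa [← scode_injective hθ', eval_substL] at this
  · exact hL L hLmem

/-- **The invariants are preserved by a step**, as long as the verdict stays `true`; and a
failed verdict stays failed. [folklore] -/
theorem stepModel_inv (kind a b c : List Bool) (st : MState)
    (hinv : st.ok = true → PoolInv st.pool ∧ LinesInv st.lines) :
    (stepModel kind a b c st).ok = true →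
      PoolInv (stepModel kind a b c st).pool ∧ LinesInv (stepModel kind a b c st).lines := by
  intro hok
  unfold stepModel at hok ⊢
  split at hok
  · rename_i n _
    unfold applyKind at hok ⊢
    split at hok
    · rename_i hn
      rw [if_pos hn]
      simp only [Bool.and_eq_true] at hok
      obtain ⟨hP, hL⟩ := hinv hok.1
      exact ⟨poolInv_cons hP hok.2, hL⟩
    · rename_i hn
      rw [if_neg hn]
      split at hok
      · rename_i r hr
        simp only [Bool.and_eq_true] at hok
        obtain ⟨hP, hL⟩ := hinv hok.1
        have hmem : r ∈ textbookFrege.rules := List.mem_of_getElem? hr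
        exact ⟨hP, linesInv_cons hmem hP hL hok.2⟩
      · simp at hok
  · simp at hok

/-- **Soundness of a run**: from the initial state, if the verdict is `true` then every
derived line is the code of a tautology (and every pool entry a code). [folklore] -/
theorem run_inv (items : List (List Bool × List Bool × List Bool × List Bool)) (st : MState)
    (hinv : st.ok = true → PoolInv st.pool ∧ LinesInv st.lines) :
    (run items st).ok = true → PoolInv (run items st).pool ∧ LinesInv (run items st).lines := by
  induction items generalizing st with
  | nil => exact hinv
  | cons i items ih =>
    obtain ⟨k, a, b, c⟩ := i
    exact ih _ (stepModel_inv k a b c st hinv)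

/-- **Soundness of the checker (model level).** If a run from the initial state ends with
verdict `true` and its last line is the code `φ.code` of a formula `φ` over `ℕ`, then `φ` is a
tautology: the last line is `scode θ` for a tautology `θ` over bit strings, `φ.code = scode
(φ.mapVars encodeNat)`, so `θ` is the binary relabelling of `φ` (`scode_injective`) and `φ` is a
tautology (relabel assignments through `decodeNat`). [cite: CookReckhow1979, §1 (closing remark) and §2 Def. 2.1–2.2] -/
theorem isTautology_of_run (items : List (List Bool × List Bool × List Bool × List Bool))
    (φ : PropForm ℕ) (hok : (run items init).ok = true)
    (hlast : (run items init).lines.head? = some φ.code) : φ.IsTautology := by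
  obtain ⟨-, hL⟩ := run_inv items init (fun _ => ⟨fun e he => by simp [init] at he,
    fun L hLm => by simp [init] at hLm⟩) hok
  obtain ⟨θ, hθ, htaut⟩ := hL _ (List.mem_of_mem_head? hlast)
  rw [code_eq_scode] at hθ
  have hθ' := scode_injective hθ
  intro τ
  have h := htaut (τ ∘ decodeNat)
  rw [← hθ', PropForm.eval_mapVars] at h
  rw [← h]
  congr 1
  funext n
  simp [Function.comp, decode_encodeNat]

end FregeVerifier

end Literature.Computability.MetaComplexity
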